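import Literature.Analysis.Calculus.LocalDegreeFormula
import Literature.Topology.Euclidean.PoincareHopfTorus
import Summits.AnomalousDissipation.AnomalousDissipation.Theses.MirrorVariety
import Mathlib.Analysis.InnerProductSpace.PiL2
import HarnessLib

/-!
# Stub `stub_signedCountIdOutside` (D1b given D1a) of the line `Sketch` (half-turn parity forcing)
# (crux stmt-AnomalousDissipation-15060, `MirrorVariety.TaylorGreenLogLoudStates`)

Brouwer-degree normalisation `deg(id) = 1` in regular-value form (Krasnosel'skiĭ–Zabreĭko,
*Geometrical Methods of Nonlinear Analysis* (1984), Thm 4.3 (algebraic count of singular points),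
Thm 6.3 (index of a nondegenerate zero `= sign det`), §3 Property 3; Chang, *Methods in Nonlinear
Analysis* (2005), §3.1, (3.4)–(3.5)): if `G : ℝⁿ → ℝⁿ` (Euclidean space) is `C¹`, `G c = c` for
`‖c‖ ≥ R > 0`, and its zero set is the finite set `S` of nondegenerate zeros, then
`∑_{c ∈ S} sign det DG(c) = 1` — GIVEN, as the hypothesis of the registered implication, the
non-periodic divergence identity D1a for the degree integrand on a box (`stub_divIdentityBox`).

Proof. `n = 0`: the space is a point, `S = {0}`, `det = 1`. `n = m + 1`: transport through
`e = EuclideanSpace.equiv` to the sup-normed model `g = e ∘ G ∘ e.symm` on `Fin (m+1) → ℝ` (still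
the identity outside the sup-ball of radius `R`; zeros `e '' S`; `Dg(e c) = e ∘ DG(c) ∘ e⁻¹` has
the same determinant, `LinearMap.det_conj`) and prove the count there
(`sum_sign_det_eq_one_of_eq_id_outside`) by the shift trick of
`Literature.Topology.Euclidean.sum_sign_det_eq_zero_of_zeros_interior`: with
`R' > max (sup_{‖x‖ ≤ R} ‖g x‖, R)` the far value `y₀ = R' e₀` has the single preimage `y₀`, near
which `g = id`; on `K = [-L, L]ᵐ⁺¹`, `L = R' + 2`, the local degree formula
(`Literature.Analysis.Calculus.setIntegral_comp_mul_det_eq_integral_mul_sum_sign`) for `g` and for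
`g - y₀` gives `∫_K φ(g) det Dg = (∫ φ) ∑_Z sign det Dg`, `∫_K φ(g - y₀) det Dg = ∫ φ` for bumps `φ`
of small support, and the compactly supported field of `exists_field_with_shifted_bump_divergence`
(adapted from `Literature.Topology.Euclidean.exists_field_with_bump_divergence`) has divergence
`φ - φ(· - y₀)`, `∫ φ = 1`, support inside `{‖v‖ ≤ R' + 1}`, missed by `g(∂K) = ∂K`; D1a yields
`0 = ∑_Z sign det Dg - 1`. No definitions, no named facts, no `sorry`.

## References

* M. A. Krasnosel'skiĭ, P. P. Zabreĭko, *Geometrical Methods of Nonlinear Analysis* (1984), Ch. 1,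
  Thm 4.3, Thm 6.3, §3 Property 3. [KrasnoselskiiZabreiko1984]
* K.-C. Chang, *Methods in Nonlinear Analysis* (2005), §3.1, (3.4)–(3.5). [Chang2005]
-/

-- `Summit.<Summit>.<Problem>` is the tree's mandated summit-side namespace (CONVENTIONS §2); duplicate deliberate.
set_option linter.dupNamespace false

noncomputable section

open MeasureTheory Set Function Metric Filter
open scoped Topology BigOperators ContDiff
open Literature.Analysis.Calculus

namespace Summit.AnomalousDissipation.AnomalousDissipation.Theorems.TaylorGreenLogLoudStates.HalfTurn.SignedCount

variable {n : ℕ}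

/-! ## A compactly supported field with divergence `φ - φ(· - R e₀)` -/

/-- In the sup norm, `r ≤ ‖v‖` with `r > 0` forces `r ≤ |vᵢ|` for some coordinate `i`.
[folklore] -/
theorem exists_le_abs_apply_of_le_norm {v : Fin (n + 1) → ℝ} {r : ℝ} (hr : 0 < r)
    (hv : r ≤ ‖v‖) : ∃ i, r ≤ |v i| := by
  by_contra h
  push Not at h
  exact (not_lt.2 hv) ((pi_norm_lt_iff hr).2 fun i => by rw [Real.norm_eq_abs]; exact h i)

/-- **A compactly supported field whose divergence is a bump minus a shifted bump.** For `δ > 0`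
and `R ≥ 0` there are a differentiable field `G : ℝⁿ⁺¹ → ℝⁿ⁺¹` and continuous `φ, ψ` with
`div G = ψ`, `∫ φ = 1`, `φ = 0` on `{‖v‖ ≥ δ}`, `ψ = φ - φ(· - R e₀)` identically, and `G = 0` on
`{‖v‖ ≥ R + δ}`: `φ(v) = ∏ᵢ θ(vᵢ)`, `ψ(v) = (θ(v₀) - θ(v₀ - R)) ∏_{i≥1} θ(vᵢ)`,
`G(v) = (Θ(v₀) - Θ(v₀ - R)) ∏_{i≥1} θ(vᵢ) · e₀`, with `θ` a normalised smooth bump supported in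
`(-δ/2, δ/2)` and `Θ(u) = ∫_{-δ}^u θ` (`Θ = 0` on `(-∞, -δ/2]`, `Θ = 1` on `[δ/2, ∞)`). Adapted from
`Literature.Topology.Euclidean.exists_field_with_bump_divergence` (Chang 2005, Lemma 3.1.2), which
records only `ψ = φ` on `{v₀ + δ ≤ R}` and no support bound. [folklore] -/
theorem exists_field_with_shifted_bump_divergence {δ : ℝ} (hδ : 0 < δ) {R : ℝ} (hR : 0 ≤ R) :
    ∃ (G : (Fin (n + 1) → ℝ) → Fin (n + 1) → ℝ) (φ ψ : (Fin (n + 1) → ℝ) → ℝ),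
      Differentiable ℝ G ∧ Continuous φ ∧ Continuous ψ ∧
      (∀ v, ∑ i, fderiv ℝ G v (Pi.single i 1) i = ψ v) ∧
      (∫ v, φ v = 1) ∧ (∀ v, δ ≤ ‖v‖ → φ v = 0) ∧
      (∀ v, ψ v = φ v - φ (v - R • Pi.single 0 1)) ∧
      (∀ v, R + δ ≤ ‖v‖ → G v = 0) := by
  -- adapted from `Literature.Topology.Euclidean.exists_field_with_bump_divergence`
  -- the one-dimensional bump `θ`, its primitive `Θ`, and the profile `A u = Θ u - Θ (u - R)`
  let b : ContDiffBump (0 : ℝ) := ⟨δ / 4, δ / 2, by positivity, by linarith⟩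
  set θ : ℝ → ℝ := b.normed volume with hθ
  have hθs : ContDiff ℝ ∞ θ := b.contDiff_normed
  have hθc : Continuous θ := b.continuous_normed
  have hθsupp : support θ = ball 0 (δ / 2) := by rw [hθ, b.support_normed_eq]
  have hθ0 : ∀ t, δ / 2 ≤ |t| → θ t = 0 := fun t ht => by
    by_contra h
    have h' : t ∈ support θ := h
    rw [hθsupp, mem_ball_zero_iff, Real.norm_eq_abs] at h'
    linarith
  have hθi : ∫ t, θ t = 1 := b.integral_normed
  set Θ : ℝ → ℝ := fun u => ∫ t in (-δ)..u, θ t with hΘ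
  have hΘd : ∀ u, HasDerivAt Θ (θ u) u := fun u =>
    (hθc.integral_hasStrictDerivAt (-δ) u).hasDerivAt
  have hΘ0 : ∀ u, u ≤ -(δ / 2) → Θ u = 0 := fun u hu => by
    simp only [hΘ]
    rw [intervalIntegral.integral_congr (g := fun _ => (0 : ℝ)) ?_, intervalIntegral.integral_zero]
    intro t ht
    have ht' : t ≤ -(δ / 2) := by
      rcases mem_uIcc.1 ht with ⟨-, h2⟩ | ⟨-, h2⟩ <;> linarith
    exact hθ0 t (by rw [abs_of_nonpos (by linarith)]; linarith)
  have hΘ1 : ∀ u, δ / 2 ≤ u → Θ u = 1 := fun u hu => by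
    simp only [hΘ]
    rw [intervalIntegral.integral_eq_integral_of_support_subset ?_, hθi]
    rw [hθsupp]
    intro t ht
    rw [mem_ball_zero_iff, Real.norm_eq_abs, abs_lt] at ht
    exact ⟨by linarith [ht.1], by linarith [ht.2]⟩
  set A : ℝ → ℝ := fun u => Θ u - Θ (u - R) with hA
  have hAd : ∀ u, HasDerivAt A (θ u - θ (u - R)) u := fun u =>
    (hΘd u).sub ((hΘd (u - R)).comp_sub_const u R)
  have hA0 : ∀ u, R + δ ≤ |u| → A u = 0 := fun u hu => by
    simp only [hA]
    rcases le_or_gt 0 u with h0 | h0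
    · rw [abs_of_nonneg h0] at hu
      rw [hΘ1 u (by linarith), hΘ1 (u - R) (by linarith), sub_self]
    · rw [abs_of_neg h0] at hu
      rw [hΘ0 u (by linarith), hΘ0 (u - R) (by linarith), sub_self]
  -- the transversal product `B v = ∏_{i ≥ 1} θ (vᵢ)`, the potential `g = A (v 0) * B v`
  set B : (Fin (n + 1) → ℝ) → ℝ := fun v => ∏ μ : Fin n, θ (v μ.succ) with hB
  have hBs : ContDiff ℝ ∞ B :=
    contDiff_prod fun μ _ => hθs.comp (contDiff_apply ℝ ℝ (Fin.succ μ))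
  have hBc : Continuous B := hBs.continuous
  have hBinv : ∀ (v : Fin (n + 1) → ℝ) (t : ℝ),
      B (v + t • (Pi.single 0 1 : Fin (n + 1) → ℝ)) = B v := by
    intro v t
    simp [hB, Fin.succ_ne_zero]
  set g : (Fin (n + 1) → ℝ) → ℝ := fun v => A (v 0) * B v with hg
  have hAdiff : Differentiable ℝ A := fun u => (hAd u).differentiableAt
  have hgd : Differentiable ℝ g :=
    (hAdiff.comp (differentiable_apply 0)).mul (hBs.differentiable (by simp))
  have hkey : ∀ v : Fin (n + 1) → ℝ,
      fderiv ℝ g v (Pi.single 0 1) = (θ (v 0) - θ (v 0 - R)) * B v := by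
    intro v
    rw [← (hgd v).lineDeriv_eq_fderiv]
    have hpath : (fun t : ℝ => g (v + t • (Pi.single 0 1 : Fin (n + 1) → ℝ))) =
        fun t => A (v 0 + t) * B v := by
      funext t
      simp only [hg, hBinv]
      simp
    have hd : HasDerivAt (fun t : ℝ => g (v + t • (Pi.single 0 1 : Fin (n + 1) → ℝ)))
        ((θ (v 0) - θ (v 0 - R)) * B v) 0 := by
      rw [hpath]
      have h := ((hAd (v 0 + 0)).comp_const_add (v 0) 0).mul_const (B v)
      simpa using h
    exact hd.deriv
  refine ⟨fun v => g v • (Pi.single 0 1 : Fin (n + 1) → ℝ), fun v => θ (v 0) * B v,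
    fun v => (θ (v 0) - θ (v 0 - R)) * B v, ?_, ?_, ?_, ?_, ?_, ?_, ?_, ?_⟩
  · exact hgd.smul_const _
  · exact (hθc.comp (continuous_apply 0)).mul hBc
  · exact ((hθc.comp (continuous_apply 0)).sub
      (hθc.comp ((continuous_apply 0).sub continuous_const))).mul hBc
  · intro v
    have hG : fderiv ℝ (fun v => g v • (Pi.single 0 1 : Fin (n + 1) → ℝ)) v =
        (fderiv ℝ g v).smulRight (Pi.single 0 1) :=
      ((hgd v).hasFDerivAt.smul_const _).fderiv
    simp only [hG, ContinuousLinearMap.smulRight_apply, Pi.smul_apply, smul_eq_mul,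
      Pi.single_apply, mul_ite, mul_one, mul_zero, Finset.sum_ite_eq', Finset.mem_univ,
      if_true]
    exact hkey v
  · -- `∫ ∏ θ(vᵢ) = ∏ ∫ θ = 1`
    have h := integral_fintype_prod_volume_eq_prod (fun (_ : Fin (n + 1)) => θ)
    have h' : (fun v : Fin (n + 1) → ℝ => θ (v 0) * B v) =
        fun v => ∏ i : Fin (n + 1), θ (v i) := by
      funext v
      rw [Fin.prod_univ_succ]
    rw [h', h, Finset.prod_eq_one fun _ _ => hθi]
  · -- `φ = 0` off the sup-ball of radius `δ`: some coordinate has modulus `≥ δ > δ / 2`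
    intro v hv
    obtain ⟨i, hi⟩ := exists_le_abs_apply_of_le_norm hδ hv
    have hθi0 : θ (v i) = 0 := hθ0 (v i) (by linarith)
    change θ (v 0) * B v = 0
    rcases Fin.eq_zero_or_eq_succ i with rfl | ⟨j, rfl⟩
    · rw [hθi0, zero_mul]
    · have : B v = 0 := Finset.prod_eq_zero (Finset.mem_univ j) hθi0
      rw [this, mul_zero]
  · -- `ψ = φ - φ(· - R e₀)`: the transversal product is invariant under the shift
    intro v
    beta_reduce
    have h1 : v - R • (Pi.single 0 1 : Fin (n + 1) → ℝ) = v + (-R) • Pi.single 0 1 := by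
      rw [neg_smul, sub_eq_add_neg]
    rw [h1, hBinv]
    simp [sub_eq_add_neg]
    ring
  · -- `G = 0` off the sup-ball of radius `R + δ`
    intro v hv
    obtain ⟨i, hi⟩ := exists_le_abs_apply_of_le_norm (by linarith) hv
    have hg0 : g v = 0 := by
      simp only [hg]
      rcases Fin.eq_zero_or_eq_succ i with rfl | ⟨j, rfl⟩
      · rw [hA0 _ hi, zero_mul]
      · have : B v = 0 := Finset.prod_eq_zero (Finset.mem_univ j) (hθ0 _ (by linarith))
        rw [this, mul_zero]
    change g v • (Pi.single 0 1 : Fin (n + 1) → ℝ) = 0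
    rw [hg0, zero_smul]

/-! ## The count in the sup-normed model `Fin (m + 1) → ℝ` -/

/-- **`∑ sign det = 1` for a `C¹` field equal to the identity outside a sup-ball, given D1a.**
Let `f : ℝᵐ⁺¹ → ℝᵐ⁺¹` (sup norm) be `C¹` with `f x = x` for `‖x‖ ≥ R > 0`, zero set the finite set
`Z`, all zeros nondegenerate, and assume the divergence identity D1a on boxes. Then
`∑_{z ∈ Z} sign det Df(z) = 1`: compare the local degree formulas at the value `0` (zeros `Z`) and at
a far value `y₀ = R' e₀`, `R' > max (sup_{‖x‖ ≤ R} ‖f x‖, R)` (single preimage `y₀`, where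
`Df = id`); the difference of the two integrands is `(div G₀)(f) det Df` for the compactly supported
field of `exists_field_with_shifted_bump_divergence`, whose integral over `[-L, L]ᵐ⁺¹`,
`L = R' + 2`, vanishes by D1a because `f = id` on the boundary, far from `tsupport G₀`.
(Krasnosel'skiĭ–Zabreĭko 1984, Thm 4.3 with Thm 6.3; Chang 2005, §3.1 (3.4)–(3.5).)
[cite: KrasnoselskiiZabreiko1984, Thm 4.3 and Thm 6.3] -/
theorem sum_sign_det_eq_one_of_eq_id_outside
    (hdiv : ∀ (n : ℕ) (a b : Fin (n + 1) → ℝ) (f G : (Fin (n + 1) → ℝ) → Fin (n + 1) → ℝ)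
        (ψ : (Fin (n + 1) → ℝ) → ℝ),
      a ≤ b → ContDiff ℝ 1 f → Differentiable ℝ G → Continuous ψ →
      (∀ v, ∑ i, fderiv ℝ G v (Pi.single i 1) i = ψ v) → HasCompactSupport G →
      (∀ x ∈ Set.Icc a b, x ∉ Set.pi Set.univ (fun i => Set.Ioo (a i) (b i)) →
        f x ∉ tsupport G) →
      ∫ x in Set.Icc a b, ψ (f x) * (fderiv ℝ f x).det = 0)
    {m : ℕ} {f : (Fin (m + 1) → ℝ) → Fin (m + 1) → ℝ} (hf : ContDiff ℝ 1 f) {R : ℝ} (hR : 0 < R)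
    (hfid : ∀ x, R ≤ ‖x‖ → f x = x) {Z : Finset (Fin (m + 1) → ℝ)} (hZ : ∀ x, x ∈ Z ↔ f x = 0)
    (hnd : ∀ z ∈ Z, (fderiv ℝ f z).det ≠ 0) :
    ∑ z ∈ Z, Real.sign (fderiv ℝ f z).det = 1 := by
  classical
  have hfc1 : Continuous (fderiv ℝ f) := hf.continuous_fderiv one_ne_zero
  -- a bound for `f` on the ball of radius `R`, and the far regular value `y₀ = R' e₀`
  obtain ⟨M, hM⟩ := (isCompact_closedBall (0 : Fin (m + 1) → ℝ) R).exists_bound_of_continuousOn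
    hf.continuous.continuousOn
  obtain ⟨R', hR'M, hR'R⟩ : ∃ R' : ℝ, M < R' ∧ R < R' :=
    ⟨max M R + 1, by linarith [le_max_left M R], by linarith [le_max_right M R]⟩
  have hR'0 : 0 < R' := hR.trans hR'R
  set y₀ : Fin (m + 1) → ℝ := R' • (Pi.single 0 1 : Fin (m + 1) → ℝ) with hy₀
  have hy₀n : ‖y₀‖ = R' := by
    rw [hy₀, norm_smul, Pi.norm_single, norm_one, mul_one, Real.norm_eq_abs, abs_of_pos hR'0]
  -- `f = id` near `y₀`, so `Df(y₀) = id` has determinant `1`; `y₀` is its only preimage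
  have hfy₀ : f y₀ = y₀ := hfid y₀ (by rw [hy₀n]; exact hR'R.le)
  have hdet₀ : (fderiv ℝ f y₀).det = 1 := by
    have h : f =ᶠ[𝓝 y₀] id := by
      have ho : IsOpen {x : Fin (m + 1) → ℝ | R < ‖x‖} := isOpen_lt continuous_const continuous_norm
      filter_upwards [ho.mem_nhds (show R < ‖y₀‖ by rw [hy₀n]; exact hR'R)] with x hx
      exact hfid x (le_of_lt hx)
    rw [h.fderiv_eq, fderiv_id]
    exact LinearMap.det_id
  have huniq : ∀ x, f x = y₀ → x = y₀ := fun x hx => by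
    by_cases hxR : R ≤ ‖x‖
    · rw [← hfid x hxR, hx]
    · have h1 : ‖f x‖ ≤ M := hM x (mem_closedBall_zero_iff.2 (not_le.1 hxR).le)
      rw [hx, hy₀n] at h1
      linarith
  -- the zeros of `f` lie in the open sup-ball of radius `R`
  have hzero : ∀ x, f x = 0 → ‖x‖ < R := fun x hx => by
    by_contra h
    have h' := hfid x (not_lt.1 h)
    rw [hx] at h'
    rw [← h', norm_zero] at h
    exact h hR
  -- the box `K = [-L, L]ᵐ⁺¹` and its interior `U`
  set L : ℝ := R' + 2 with hL
  set K : Set (Fin (m + 1) → ℝ) := Icc (fun _ => -L) (fun _ => L) with hK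
  set U : Set (Fin (m + 1) → ℝ) := Set.pi univ fun _ => Ioo (-L) L with hU
  have hKc : IsCompact K := isCompact_Icc
  have hUo : IsOpen U := isOpen_set_pi finite_univ fun _ _ => isOpen_Ioo
  have hUK : U ⊆ K := fun x hx =>
    ⟨fun i => (hx i (mem_univ i)).1.le, fun i => (hx i (mem_univ i)).2.le⟩
  have hnormU : ∀ x : Fin (m + 1) → ℝ, ‖x‖ < L → x ∈ U := fun x hx i _ => by
    have h1 := (norm_le_pi_norm x i).trans_lt hx
    rw [Real.norm_eq_abs, abs_lt] at h1
    exact ⟨h1.1, h1.2⟩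
  -- (i) the local degree formula for `f` at the value `0`
  have hZU : (↑Z : Set (Fin (m + 1) → ℝ)) ⊆ U := fun z hz =>
    hnormU z ((hzero z ((hZ z).1 hz)).trans (hR'R.trans (by linarith)))
  obtain ⟨δ₁, hδ₁, hloc₁⟩ := setIntegral_comp_mul_det_eq_integral_mul_sum_sign volume hf hKc hUo
    hUK hZU (fun x _ hx => (hZ x).2 hx) (fun z hz => (hZ z).1 hz) hnd
  -- (ii) the local degree formula for `f - y₀` at the value `0`
  have hf₂ : ContDiff ℝ 1 (fun x => f x - y₀) := hf.sub contDiff_const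
  have hDf₂ : ∀ x, fderiv ℝ (fun x => f x - y₀) x = fderiv ℝ f x := fun x => fderiv_sub_const y₀
  have hy₀U : (↑({y₀} : Finset (Fin (m + 1) → ℝ)) : Set (Fin (m + 1) → ℝ)) ⊆ U := by
    intro z hz
    rw [Finset.coe_singleton, mem_singleton_iff] at hz
    rw [hz]
    exact hnormU _ (by rw [hy₀n]; linarith)
  obtain ⟨δ₂, hδ₂, hloc₂⟩ := setIntegral_comp_mul_det_eq_integral_mul_sum_sign volume hf₂ hKc hUo
    hUK hy₀U (fun x _ hx => Finset.mem_singleton.2 (huniq x (sub_eq_zero.1 hx)))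
    (fun z hz => by rw [Finset.mem_singleton.1 hz]; exact sub_eq_zero.2 hfy₀)
    (fun z hz => by rw [Finset.mem_singleton.1 hz, hDf₂, hdet₀]; exact one_ne_zero)
  -- (iii) the compactly supported field with divergence `φ - φ(· - y₀)`, `φ` supported in `‖v‖ < δ`
  set δ : ℝ := min (min δ₁ δ₂) 1 with hδ
  have hδ0 : 0 < δ := lt_min (lt_min hδ₁ hδ₂) one_pos
  have hδ1 : δ ≤ 1 := min_le_right _ _
  obtain ⟨G, φ, ψ, hGd, hφc, hψc, hGdiv, hφ1, hφ0, hψφ, hG0⟩ :=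
    exists_field_with_shifted_bump_divergence (n := m) hδ0 hR'0.le
  have hφ0₁ : ∀ v, δ₁ ≤ ‖v‖ → φ v = 0 := fun v hv =>
    hφ0 v (((min_le_left _ _).trans (min_le_left _ _)).trans hv)
  have hφ0₂ : ∀ v, δ₂ ≤ ‖v‖ → φ v = 0 := fun v hv =>
    hφ0 v (((min_le_left _ _).trans (min_le_right _ _)).trans hv)
  have htsupp : tsupport G ⊆ closedBall 0 (R' + δ) :=
    closure_minimal (fun v hv => mem_closedBall_zero_iff.2 (not_lt.1 fun h => hv (hG0 v h.le)))
      isClosed_closedBall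
  have hGc : HasCompactSupport G :=
    IsCompact.of_isClosed_subset (isCompact_closedBall _ _) (isClosed_tsupport G) htsupp
  -- (iv) D1a on the box: its boundary points `x` satisfy `f x = x ∉ tsupport G`
  have hbd : ∀ x ∈ K, x ∉ U → f x ∉ tsupport G := fun x _ hxU htx => by
    have hxL : L ≤ ‖x‖ := not_lt.1 fun h => hxU (hnormU x h)
    rw [hfid x (by linarith)] at htx
    have h2 := mem_closedBall_zero_iff.1 (htsupp htx)
    linarith
  have hle : (fun _ => -L : Fin (m + 1) → ℝ) ≤ fun _ => L := fun _ => show -L ≤ L by linarith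
  have h0 : ∫ x in K, ψ (f x) * (fderiv ℝ f x).det = 0 :=
    hdiv m (fun _ => -L) (fun _ => L) f G ψ hle hf hGd hψc hGdiv hGc hbd
  -- (v) split `ψ(f) det Df = φ(f) det Df - φ(f - y₀) det Df` and evaluate both pieces
  have hI₁ := hloc₁ φ hφc hφ0₁
  have hI₂ := hloc₂ φ hφc hφ0₂
  rw [hφ1, one_mul] at hI₁ hI₂
  simp_rw [hDf₂] at hI₂
  rw [Finset.sum_singleton, hdet₀, Real.sign_one] at hI₂
  have hcont₁ : Continuous fun x => φ (f x) * (fderiv ℝ f x).det :=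
    (hφc.comp hf.continuous).mul (ContinuousLinearMap.continuous_det.comp hfc1)
  have hcont₂ : Continuous fun x => φ (f x - y₀) * (fderiv ℝ f x).det :=
    (hφc.comp (hf.continuous.sub continuous_const)).mul
      (ContinuousLinearMap.continuous_det.comp hfc1)
  have hsplit : ∫ x in K, ψ (f x) * (fderiv ℝ f x).det =
      (∫ x in K, φ (f x) * (fderiv ℝ f x).det) - ∫ x in K, φ (f x - y₀) * (fderiv ℝ f x).det := by
    rw [← integral_sub (hcont₁.continuousOn.integrableOn_compact hKc)
      (hcont₂.continuousOn.integrableOn_compact hKc)]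
    refine setIntegral_congr_fun hKc.measurableSet fun x _ => ?_
    rw [hψφ (f x)]
    ring
  rw [hsplit, hI₁, hI₂] at h0
  linarith

/-! ## The registered stub -/

/-- **Stub `stub_signedCountIdOutside`** (D1b given D1a, = `DivIdentityBox → SignedCountIdOutside`):
Brouwer degree normalisation `deg(id) = 1` in regular-value form — assuming the divergence identity
D1a on boxes, a `C¹` field `G` on `EuclideanSpace ℝ (Fin n)` with `G c = c` for `‖c‖ ≥ R > 0`,
whose zero set is the finite set `S` of nondegenerate zeros, has `∑_{c ∈ S} sign det DG(c) = 1`.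
For `n = 0` the space is a point (`S = {0}`, `det = 1`); for `n = m + 1` transport through
`EuclideanSpace.equiv` to the sup-normed model (`sum_sign_det_eq_one_of_eq_id_outside`), the
determinants at the zeros being invariant under conjugation (`LinearMap.det_conj`).
(Krasnosel'skiĭ–Zabreĭko 1984, Thm 4.3, Thm 6.3, §3 Property 3; Chang 2005, §3.1 (3.4)–(3.5).)
[cite: KrasnoselskiiZabreiko1984, Thm 4.3 with Thm 6.3 and §3 Property 3] -/
theorem stub_signedCountIdOutside :
    (∀ (n : ℕ) (a b : Fin (n + 1) → ℝ) (f G : (Fin (n + 1) → ℝ) → Fin (n + 1) → ℝ) (ψ : (Fin (n + 1) → ℝ) → ℝ),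
      a ≤ b → ContDiff ℝ 1 f → Differentiable ℝ G → Continuous ψ →
      (∀ v, ∑ i, fderiv ℝ G v (Pi.single i 1) i = ψ v) → HasCompactSupport G →
      (∀ x ∈ Set.Icc a b, x ∉ Set.pi Set.univ (fun i => Set.Ioo (a i) (b i)) → f x ∉ tsupport G) →
      ∫ x in Set.Icc a b, ψ (f x) * (fderiv ℝ f x).det = 0) →
    ∀ (n : ℕ) (G : EuclideanSpace ℝ (Fin n) → EuclideanSpace ℝ (Fin n)) (R : ℝ)
      (S : Finset (EuclideanSpace ℝ (Fin n))),
    0 < R → ContDiff ℝ 1 G → (∀ c, R ≤ ‖c‖ → G c = c) → (∀ c, c ∈ S ↔ G c = 0) →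
    (∀ c ∈ S, (fderiv ℝ G c).det ≠ 0) →
    ∑ c ∈ S, Real.sign ((fderiv ℝ G c).det) = 1 := by
  intro hdiv n G R S hR hG hGid hS hnd
  rcases n with _ | m
  · -- dimension `0`: the space is a point
    have h0 : ∀ c : EuclideanSpace ℝ (Fin 0), c = 0 :=
      finrank_zero_iff_forall_zero.1 (finrank_euclideanSpace_fin (𝕜 := ℝ) (n := 0))
    have hS0 : S = {0} :=
      Finset.eq_singleton_iff_unique_mem.2 ⟨(hS 0).2 (h0 _), fun c _ => h0 c⟩
    rw [hS0, Finset.sum_singleton]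
    have hdet : (fderiv ℝ G 0).det = 1 :=
      LinearMap.det_eq_one_of_finrank_eq_zero (finrank_euclideanSpace_fin (𝕜 := ℝ) (n := 0)) _
    rw [hdet, Real.sign_one]
  · -- dimension `m + 1`: transport to the sup-normed model `Fin (m + 1) → ℝ`
    classical
    set e := EuclideanSpace.equiv (Fin (m + 1)) ℝ with he
    set g : (Fin (m + 1) → ℝ) → Fin (m + 1) → ℝ := fun v => e (G (e.symm v)) with hg
    have hgc : ContDiff ℝ 1 g := e.contDiff.comp (hG.comp e.symm.contDiff)
    have hnorm : ∀ c : EuclideanSpace ℝ (Fin (m + 1)), ‖e c‖ ≤ ‖c‖ := fun c =>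
      (pi_norm_le_iff_of_nonneg (norm_nonneg c)).2 fun i => PiLp.norm_apply_le c i
    have hgid : ∀ v, R ≤ ‖v‖ → g v = v := by
      intro v hv
      have h1 : R ≤ ‖e.symm v‖ := hv.trans (by simpa using hnorm (e.symm v))
      simp only [hg]
      rw [hGid _ h1, e.apply_symm_apply]
    have hgZ : ∀ v, v ∈ S.image e ↔ g v = 0 := by
      intro v
      simp only [hg, Finset.mem_image]
      constructor
      · rintro ⟨c, hc, rfl⟩
        rw [e.symm_apply_apply, (hS c).1 hc, map_zero]
      · intro hv
        exact ⟨e.symm v, (hS _).2 (e.map_eq_zero_iff.1 hv), e.apply_symm_apply v⟩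
    have hD : ∀ c, fderiv ℝ g (e c) =
        (e : _ →L[ℝ] _).comp ((fderiv ℝ G c).comp (e.symm : _ →L[ℝ] _)) := by
      intro c
      have h1 : g = e ∘ (G ∘ e.symm) := rfl
      rw [h1, e.comp_fderiv, e.symm.comp_right_fderiv, e.symm_apply_apply]
    have hdet : ∀ c, (fderiv ℝ g (e c)).det = (fderiv ℝ G c).det := by
      intro c
      rw [hD]
      exact LinearMap.det_conj ((fderiv ℝ G c : _ →L[ℝ] _) : _ →ₗ[ℝ] _) e.toLinearEquiv
    have key := sum_sign_det_eq_one_of_eq_id_outside hdiv hgc hR hgid hgZ (fun z hz => by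
      obtain ⟨c, hc, rfl⟩ := Finset.mem_image.1 hz
      rw [hdet]
      exact hnd c hc)
    rw [Finset.sum_image fun c _ c' _ h => e.injective h] at key
    simpa only [hdet] using key

end Summit.AnomalousDissipation.AnomalousDissipation.Theorems.TaylorGreenLogLoudStates.HalfTurn.SignedCount

end
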